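import Summits.CriticalPhenomena.PercolationContinuityZ3.Theorems.PercNearOneGluingNoHeavyLowerTailSahiTwoLevelCostlessSlots

/-!
# The W-FORM of the two-level TOP form: `T⁺ = E_3(G) + E_3(H_0,G_1,G_2) + (manifestly ≥ 0) − 2·μ(W_0)`

Support file of the one-cut programme (crux `NoHeavyLowerTail`, stmt-CriticalPhenomena-4575; cell `prim-bnk`, seat bnk-2 gen 15;
measure-level companion of prim-ineq-gen-4's coefficientwise W-form `…SahiGridPatternWForm.sStarD_upperStep_wForm` (their memo
`run/shared/lean/prim/prim-ineq-gen-4/FINDING-W-FORM-g14.md`, ASK (a) of `prim-l12/prim-bnk-2/FROM-prim-ineq-gen-4-g14-W-FORM.md`);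
this lane's memo `run/shared/lean/prim/prim-l12/FROM-prim-bnk-2-g15-*.md`).

For two triples of events `G = (G_0,G_1,G_2)`, `H = (H_0,H_1,H_2)` under a product measure `μ` write `T⁺(G,H) := twoLevelForm μ G H − ∏_i (μ(G_i) − μ(H_i))`
(`…SahiTwoLevelC3`; `SahiTwoLevelPlus` says `T⁺ ≥ 0` for nested triples of increasing events and implies Kahn's Conjecture 5).
**THE W-FORM** (`twoLevelTop_eq_wForm₀`, a `ring` identity in the moments — no hypothesis on `G, H` at all; slot `0` designated):

`T⁺(G,H) = E_3(G_0,G_1,G_2) + E_3(H_0,G_1,G_2) + δ_1·Cov(G_0,G_2) + δ_2·Cov(G_0,G_1)`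
`         + μ(G_2)·[μ(H_0G_1) − μ(H_0H_1)] + μ(G_1)·[μ(H_0G_2) − μ(H_0H_2)] + μ(G_0)·[μ(G_1G_2) − μ(H_1H_2)] − 2·[μ(H_0G_1G_2) − μ(H_0H_1H_2)]`,

`δ_i = μ(G_i) − μ(H_i)`.  For a nested pair (`H_i ⊆ G_i`) the last bracket is `μ(W_0)`, `W_0 := H_0 ∩ G_1 ∩ G_2 ∖ (H_1 ∩ H_2)` (the part of
the `0`-bottom lying in both other tops but not in both other bottoms) and every other remainder term is manifestly `≥ 0` when the `G_i`
are increasing (Harris twice, monotonicity thrice): **`T⁺ ≥ E_3(G) + E_3(H_0,G_1,G_2) − 2μ(W_0)`** (`sahiE3_add_sahiE3_sub_le_twoLevelTop`).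
Consequences:
* **W-FACE** (`μ(W_0) = 0`, here as the set condition `H_0 ∩ G_1 ∩ G_2 ⊆ H_1 ∩ H_2`): `T⁺ ≥ E_3(G) + E_3(H_0,G_1,G_2)`
  (`sahiE3_add_sahiE3_le_twoLevelTop_of_wFace₀`), so `SahiTwoLevelPlus` holds on this face given `C_3` for the two triples
  `(G_0,G_1,G_2)`, `(H_0,G_1,G_2)` (`twoLevelTop_nonneg_of_wFace₀`, `…_of_kahn`).  The W-face CONTAINS the costless face of
  `…SahiTwoLevelCostlessSlots` (`G_0G_1G_2 ⊆ H_1 ∩ H_2`, `wFace₀_of_costless₁₂`), the empty-bottom face `H_0 = ∅` and the new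
  MEET-BOTTOM face `H_0 ⊆ H_1 ∩ H_2` (`wFace₀_of_meetBottom`) — it is prim-ineq-gen-4's observation that bnk-2 gen 10's "THEOREM A″"
  only needs that no point of the `0`-bottom lies in `G_1G_2 ∖ H_1H_2`.
* **MEET-BOTTOM INCREMENT** (`twoLevelTop_meetBottom_sub_eq`): if `H_0 ⊆ H_1 ∩ H_2 ⊆ G_1 ∩ G_2` then emptying the `0`-bottom changes `T⁺` by
  exactly `E_3(H_0,G_1,G_2)`: `T⁺(G,H) − T⁺(G,H[0 ↦ ∅]) = E_3(H_0,G_1,G_2)`.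
HONEST LABEL: identities and faces of `SahiTwoLevelPlus` conditional on `C_3` for two explicit triples; nothing here asserts
`SahiTwoLevelPlus` or `C_3`.  (Coefficientwise, prim-ineq-gen-4: on the W-face `c_2 ≥ 2c_3 + c(H_0,G_1,G_2)`; proved faces cover
96.8 % of the exhaustive `m = 4` comb cells.) [this work]
-/

noncomputable section

open scoped Classical

namespace Summit.CriticalPhenomena.PercolationContinuityZ3.Theorems.SahiTwoLevelWForm

open Finset Function MeasureTheory
open Literature.Combinatorics.Sahi2008
open Literature.Probability.LatticeModels (prodBernoulli prodBernoulli_harris sahiE3 sahiE3_def)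

variable {κ : Type}

/-! ### The identity -/

/-- **The W-form of the two-level TOP form** (slot `0` designated; a ring identity in the moments, valid for ANY two triples of
events):
`T⁺ = E_3(G_0,G_1,G_2) + E_3(H_0,G_1,G_2) + δ_1 Cov(G_0,G_2) + δ_2 Cov(G_0,G_1) + μ(G_2)(μ(H_0G_1) − μ(H_0H_1)) + μ(G_1)(μ(H_0G_2) − μ(H_0H_2))
 + μ(G_0)(μ(G_1G_2) − μ(H_1H_2)) − 2(μ(H_0G_1G_2) − μ(H_0H_1H_2))`.  Measure shadow of prim-ineq-gen-4's coefficientwise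
`sStarD_upperStep_wForm`. [this work] -/
theorem twoLevelTop_eq_wForm₀ (q : κ → unitInterval) (G H : Fin 3 → Set (Set κ)) :
    twoLevelForm (fun A => (prodBernoulli q).real A) G H
        - ∏ i, ((prodBernoulli q).real (G i) - (prodBernoulli q).real (H i)) =
      sahiE3 (prodBernoulli q) (G 0) (G 1) (G 2) + sahiE3 (prodBernoulli q) (H 0) (G 1) (G 2)
      + ((prodBernoulli q).real (G 1) - (prodBernoulli q).real (H 1))
          * ((prodBernoulli q).real (G 0 ∩ G 2) - (prodBernoulli q).real (G 0) * (prodBernoulli q).real (G 2))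
      + ((prodBernoulli q).real (G 2) - (prodBernoulli q).real (H 2))
          * ((prodBernoulli q).real (G 0 ∩ G 1) - (prodBernoulli q).real (G 0) * (prodBernoulli q).real (G 1))
      + (prodBernoulli q).real (G 2) * ((prodBernoulli q).real (H 0 ∩ G 1) - (prodBernoulli q).real (H 0 ∩ H 1))
      + (prodBernoulli q).real (G 1) * ((prodBernoulli q).real (H 0 ∩ G 2) - (prodBernoulli q).real (H 0 ∩ H 2))
      + (prodBernoulli q).real (G 0) * ((prodBernoulli q).real (G 1 ∩ G 2) - (prodBernoulli q).real (H 1 ∩ H 2))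
      - 2 * ((prodBernoulli q).real (H 0 ∩ G 1 ∩ G 2) - (prodBernoulli q).real (H 0 ∩ H 1 ∩ H 2)) := by
  simp only [twoLevelForm, Fin.prod_univ_three, sahiE3_def]
  ring

/-- For a nested pair the W-mass `μ(H_0G_1G_2) − μ(H_0H_1H_2)` is the measure of `W_0 = H_0 ∩ G_1 ∩ G_2 ∖ (H_1 ∩ H_2)`, in particular
`≥ 0`. [this work] -/
theorem wMass₀_nonneg (q : κ → unitInterval) (G H : Fin 3 → Set (Set κ)) (hH1 : H 1 ⊆ G 1) (hH2 : H 2 ⊆ G 2) :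
    0 ≤ (prodBernoulli q).real (H 0 ∩ G 1 ∩ G 2) - (prodBernoulli q).real (H 0 ∩ H 1 ∩ H 2) :=
  sub_nonneg.2 (measureReal_mono
    (Set.inter_subset_inter (Set.inter_subset_inter_right _ hH1) hH2))

/-! ### The lower bound `T⁺ ≥ E_3(G) + E_3(H_0,G_1,G_2) − 2μ(W_0)` and the W-face -/

/-- **`T⁺ ≥ E_3(G_0,G_1,G_2) + E_3(H_0,G_1,G_2) − 2·μ(W_0)`** for every nested pair whose top triple is increasing (Harris for
`(G_0,G_1)`, `(G_0,G_2)`; monotonicity). [this work] -/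
theorem sahiE3_add_sahiE3_sub_le_twoLevelTop [Fintype κ] (q : κ → unitInterval) (G H : Fin 3 → Set (Set κ))
    (hG : ∀ i, IsUpperSet (G i)) (hH1 : H 1 ⊆ G 1) (hH2 : H 2 ⊆ G 2) :
    sahiE3 (prodBernoulli q) (G 0) (G 1) (G 2) + sahiE3 (prodBernoulli q) (H 0) (G 1) (G 2)
        - 2 * ((prodBernoulli q).real (H 0 ∩ G 1 ∩ G 2) - (prodBernoulli q).real (H 0 ∩ H 1 ∩ H 2)) ≤
      twoLevelForm (fun A => (prodBernoulli q).real A) G H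
        - ∏ i, ((prodBernoulli q).real (G i) - (prodBernoulli q).real (H i)) := by
  rw [twoLevelTop_eq_wForm₀ q G H]
  have hδ1 : 0 ≤ (prodBernoulli q).real (G 1) - (prodBernoulli q).real (H 1) := sub_nonneg.2 (measureReal_mono hH1)
  have hδ2 : 0 ≤ (prodBernoulli q).real (G 2) - (prodBernoulli q).real (H 2) := sub_nonneg.2 (measureReal_mono hH2)
  have hcv1 : 0 ≤ (prodBernoulli q).real (G 0 ∩ G 1) - (prodBernoulli q).real (G 0) * (prodBernoulli q).real (G 1) :=
    sub_nonneg.2 (prodBernoulli_harris q (hG 0) (hG 1) MeasurableSet.of_discrete MeasurableSet.of_discrete)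
  have hcv2 : 0 ≤ (prodBernoulli q).real (G 0 ∩ G 2) - (prodBernoulli q).real (G 0) * (prodBernoulli q).real (G 2) :=
    sub_nonneg.2 (prodBernoulli_harris q (hG 0) (hG 2) MeasurableSet.of_discrete MeasurableSet.of_discrete)
  have hm1 : 0 ≤ (prodBernoulli q).real (H 0 ∩ G 1) - (prodBernoulli q).real (H 0 ∩ H 1) :=
    sub_nonneg.2 (measureReal_mono (Set.inter_subset_inter_right _ hH1))
  have hm2 : 0 ≤ (prodBernoulli q).real (H 0 ∩ G 2) - (prodBernoulli q).real (H 0 ∩ H 2) :=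
    sub_nonneg.2 (measureReal_mono (Set.inter_subset_inter_right _ hH2))
  have hm : 0 ≤ (prodBernoulli q).real (G 1 ∩ G 2) - (prodBernoulli q).real (H 1 ∩ H 2) :=
    sub_nonneg.2 (measureReal_mono (Set.inter_subset_inter hH1 hH2))
  have hg0 : 0 ≤ (prodBernoulli q).real (G 0) := measureReal_nonneg
  have hg1 : 0 ≤ (prodBernoulli q).real (G 1) := measureReal_nonneg
  have hg2 : 0 ≤ (prodBernoulli q).real (G 2) := measureReal_nonneg
  nlinarith [mul_nonneg hδ1 hcv2, mul_nonneg hδ2 hcv1, mul_nonneg hg2 hm1, mul_nonneg hg1 hm2, mul_nonneg hg0 hm]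

/-- **The W-face, exact form**: if `H_1 ⊆ G_1`, `H_2 ⊆ G_2` and `H_0 ∩ G_1 ∩ G_2 ⊆ H_1 ∩ H_2` (no point of the `0`-bottom lies in
`G_1G_2 ∖ H_1H_2`, i.e. `W_0 = ∅`) then the W-term drops out:
`T⁺ = E_3(G) + E_3(H_0,G_1,G_2) + δ_1 Cov(G_0,G_2) + δ_2 Cov(G_0,G_1) + μ(G_2)μ(H_0 ∩ D_1) + μ(G_1)μ(H_0 ∩ D_2) + μ(G_0)μ(G_1G_2 ∖ H_1H_2)`. [this work] -/
theorem twoLevelTop_eq_of_wFace₀ (q : κ → unitInterval) (G H : Fin 3 → Set (Set κ)) (hH1 : H 1 ⊆ G 1) (hH2 : H 2 ⊆ G 2)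
    (hW : H 0 ∩ G 1 ∩ G 2 ⊆ H 1 ∩ H 2) :
    twoLevelForm (fun A => (prodBernoulli q).real A) G H
        - ∏ i, ((prodBernoulli q).real (G i) - (prodBernoulli q).real (H i)) =
      sahiE3 (prodBernoulli q) (G 0) (G 1) (G 2) + sahiE3 (prodBernoulli q) (H 0) (G 1) (G 2)
      + ((prodBernoulli q).real (G 1) - (prodBernoulli q).real (H 1))
          * ((prodBernoulli q).real (G 0 ∩ G 2) - (prodBernoulli q).real (G 0) * (prodBernoulli q).real (G 2))
      + ((prodBernoulli q).real (G 2) - (prodBernoulli q).real (H 2))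
          * ((prodBernoulli q).real (G 0 ∩ G 1) - (prodBernoulli q).real (G 0) * (prodBernoulli q).real (G 1))
      + (prodBernoulli q).real (G 2) * ((prodBernoulli q).real (H 0 ∩ G 1) - (prodBernoulli q).real (H 0 ∩ H 1))
      + (prodBernoulli q).real (G 1) * ((prodBernoulli q).real (H 0 ∩ G 2) - (prodBernoulli q).real (H 0 ∩ H 2))
      + (prodBernoulli q).real (G 0) * ((prodBernoulli q).real (G 1 ∩ G 2) - (prodBernoulli q).real (H 1 ∩ H 2)) := by
  have e3 : H 0 ∩ H 1 ∩ H 2 = H 0 ∩ G 1 ∩ G 2 := by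
    ext ω; simp only [Set.mem_inter_iff]
    exact ⟨fun ⟨⟨a, b⟩, c⟩ => ⟨⟨a, hH1 b⟩, hH2 c⟩,
      fun ⟨⟨a, b⟩, c⟩ => ⟨⟨a, (hW ⟨⟨a, b⟩, c⟩).1⟩, (hW ⟨⟨a, b⟩, c⟩).2⟩⟩
  rw [twoLevelTop_eq_wForm₀ q G H, e3]
  ring

/-- **`T⁺ ≥ E_3(G_0,G_1,G_2) + E_3(H_0,G_1,G_2)` on the W-face** (`H_0 ∩ G_1 ∩ G_2 ⊆ H_1 ∩ H_2`, top triple increasing). [this work] -/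
theorem sahiE3_add_sahiE3_le_twoLevelTop_of_wFace₀ [Fintype κ] (q : κ → unitInterval) (G H : Fin 3 → Set (Set κ))
    (hG : ∀ i, IsUpperSet (G i)) (hH1 : H 1 ⊆ G 1) (hH2 : H 2 ⊆ G 2) (hW : H 0 ∩ G 1 ∩ G 2 ⊆ H 1 ∩ H 2) :
    sahiE3 (prodBernoulli q) (G 0) (G 1) (G 2) + sahiE3 (prodBernoulli q) (H 0) (G 1) (G 2) ≤
      twoLevelForm (fun A => (prodBernoulli q).real A) G H
        - ∏ i, ((prodBernoulli q).real (G i) - (prodBernoulli q).real (H i)) := by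
  have e3 : (prodBernoulli q).real (H 0 ∩ G 1 ∩ G 2) - (prodBernoulli q).real (H 0 ∩ H 1 ∩ H 2) = 0 := by
    have : H 0 ∩ H 1 ∩ H 2 = H 0 ∩ G 1 ∩ G 2 := by
      ext ω; simp only [Set.mem_inter_iff]
      exact ⟨fun ⟨⟨a, b⟩, c⟩ => ⟨⟨a, hH1 b⟩, hH2 c⟩,
        fun ⟨⟨a, b⟩, c⟩ => ⟨⟨a, (hW ⟨⟨a, b⟩, c⟩).1⟩, (hW ⟨⟨a, b⟩, c⟩).2⟩⟩
    rw [this, sub_self]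
  have h := sahiE3_add_sahiE3_sub_le_twoLevelTop q G H hG hH1 hH2
  rw [e3, mul_zero, sub_zero] at h
  exact h

/-- **`SahiTwoLevelPlus` on the W-face from `C_3`** for `(G_0,G_1,G_2)` and `(H_0,G_1,G_2)`. [this work] -/
theorem twoLevelTop_nonneg_of_wFace₀ [Fintype κ] (q : κ → unitInterval) (G H : Fin 3 → Set (Set κ))
    (hG : ∀ i, IsUpperSet (G i)) (hH1 : H 1 ⊆ G 1) (hH2 : H 2 ⊆ G 2) (hW : H 0 ∩ G 1 ∩ G 2 ⊆ H 1 ∩ H 2)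
    (hE₃G : 0 ≤ sahiE3 (prodBernoulli q) (G 0) (G 1) (G 2)) (hE₃H : 0 ≤ sahiE3 (prodBernoulli q) (H 0) (G 1) (G 2)) :
    0 ≤ twoLevelForm (fun A => (prodBernoulli q).real A) G H
        - ∏ i, ((prodBernoulli q).real (G i) - (prodBernoulli q).real (H i)) :=
  le_trans (add_nonneg hE₃G hE₃H) (sahiE3_add_sahiE3_le_twoLevelTop_of_wFace₀ q G H hG hH1 hH2 hW)

/-- The same from Kahn's Conjecture 5 (`H_0` increasing as well). [this work] -/
theorem twoLevelTop_nonneg_of_wFace₀_of_kahn [Fintype κ] (hK : KahnConjecture) (q : κ → unitInterval)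
    (G H : Fin 3 → Set (Set κ)) (hG : ∀ i, IsUpperSet (G i)) (hH0u : IsUpperSet (H 0))
    (hH1 : H 1 ⊆ G 1) (hH2 : H 2 ⊆ G 2) (hW : H 0 ∩ G 1 ∩ G 2 ⊆ H 1 ∩ H 2) :
    0 ≤ twoLevelForm (fun A => (prodBernoulli q).real A) G H
        - ∏ i, ((prodBernoulli q).real (G i) - (prodBernoulli q).real (H i)) :=
  twoLevelTop_nonneg_of_wFace₀ q G H hG hH1 hH2 hW (hK κ q _ _ _ (hG 0) (hG 1) (hG 2))
    (hK κ q _ _ _ hH0u (hG 1) (hG 2))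

/-! ### Sub-faces of the W-face -/

/-- The costless face of `…SahiTwoLevelCostlessSlots` (`G_0G_1G_2 ⊆ H_1`, `⊆ H_2`) lies in the W-face. [this work] -/
theorem wFace₀_of_costless₁₂ (G H : Fin 3 → Set (Set κ)) (hH0 : H 0 ⊆ G 0)
    (hc1 : G 0 ∩ G 1 ∩ G 2 ⊆ H 1) (hc2 : G 0 ∩ G 1 ∩ G 2 ⊆ H 2) : H 0 ∩ G 1 ∩ G 2 ⊆ H 1 ∩ H 2 :=
  fun _ ⟨⟨a, b⟩, c⟩ => ⟨hc1 ⟨⟨hH0 a, b⟩, c⟩, hc2 ⟨⟨hH0 a, b⟩, c⟩⟩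

/-- The MEET-BOTTOM face `H_0 ⊆ H_1 ∩ H_2` (e.g. all three bottoms equal) lies in the W-face. [this work] -/
theorem wFace₀_of_meetBottom (G H : Fin 3 → Set (Set κ)) (hm : H 0 ⊆ H 1 ∩ H 2) : H 0 ∩ G 1 ∩ G 2 ⊆ H 1 ∩ H 2 :=
  fun _ ⟨⟨a, _⟩, _⟩ => hm a

/-- The EMPTY-BOTTOM face `H_0 = ∅` lies in the W-face. [this work] -/
theorem wFace₀_of_empty (G H : Fin 3 → Set (Set κ)) (h0 : H 0 = ∅) : H 0 ∩ G 1 ∩ G 2 ⊆ H 1 ∩ H 2 := by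
  rw [h0, Set.empty_inter, Set.empty_inter]; exact Set.empty_subset _

/-- **`SahiTwoLevelPlus` on the meet-bottom face from Kahn's Conjecture 5.** [this work] -/
theorem twoLevelTop_nonneg_of_meetBottom_of_kahn [Fintype κ] (hK : KahnConjecture) (q : κ → unitInterval)
    (G H : Fin 3 → Set (Set κ)) (hG : ∀ i, IsUpperSet (G i)) (hH0u : IsUpperSet (H 0))
    (hH1 : H 1 ⊆ G 1) (hH2 : H 2 ⊆ G 2) (hm : H 0 ⊆ H 1 ∩ H 2) :
    0 ≤ twoLevelForm (fun A => (prodBernoulli q).real A) G H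
        - ∏ i, ((prodBernoulli q).real (G i) - (prodBernoulli q).real (H i)) :=
  twoLevelTop_nonneg_of_wFace₀_of_kahn hK q G H hG hH0u hH1 hH2 (wFace₀_of_meetBottom G H hm)

/-! ### The meet-bottom increment -/

/-- **Meet-bottom exact form**: if `H_0 ⊆ H_1 ∩ H_2` and `H_1 ⊆ G_1`, `H_2 ⊆ G_2` then
`T⁺ = E_3(G) + E_3(H_0,G_1,G_2) + δ_1 Cov(G_0,G_2) + δ_2 Cov(G_0,G_1) + μ(G_0)·μ(G_1G_2 ∖ H_1H_2)` (the two `H_0 ∩ D_a` terms vanish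
as well). [this work] -/
theorem twoLevelTop_eq_of_meetBottom (q : κ → unitInterval) (G H : Fin 3 → Set (Set κ)) (hH1 : H 1 ⊆ G 1) (hH2 : H 2 ⊆ G 2)
    (hm : H 0 ⊆ H 1 ∩ H 2) :
    twoLevelForm (fun A => (prodBernoulli q).real A) G H
        - ∏ i, ((prodBernoulli q).real (G i) - (prodBernoulli q).real (H i)) =
      sahiE3 (prodBernoulli q) (G 0) (G 1) (G 2) + sahiE3 (prodBernoulli q) (H 0) (G 1) (G 2)
      + ((prodBernoulli q).real (G 1) - (prodBernoulli q).real (H 1))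
          * ((prodBernoulli q).real (G 0 ∩ G 2) - (prodBernoulli q).real (G 0) * (prodBernoulli q).real (G 2))
      + ((prodBernoulli q).real (G 2) - (prodBernoulli q).real (H 2))
          * ((prodBernoulli q).real (G 0 ∩ G 1) - (prodBernoulli q).real (G 0) * (prodBernoulli q).real (G 1))
      + (prodBernoulli q).real (G 0) * ((prodBernoulli q).real (G 1 ∩ G 2) - (prodBernoulli q).real (H 1 ∩ H 2)) := by
  have e01 : H 0 ∩ H 1 = H 0 := Set.inter_eq_left.2 fun ω h => (hm h).1
  have e02 : H 0 ∩ H 2 = H 0 := Set.inter_eq_left.2 fun ω h => (hm h).2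
  have e01' : H 0 ∩ G 1 = H 0 := Set.inter_eq_left.2 fun ω h => hH1 (hm h).1
  have e02' : H 0 ∩ G 2 = H 0 := Set.inter_eq_left.2 fun ω h => hH2 (hm h).2
  rw [twoLevelTop_eq_of_wFace₀ q G H hH1 hH2 (wFace₀_of_meetBottom G H hm), e01, e02, e01', e02']
  ring

/-- **The meet-bottom increment**: on the meet-bottom face, emptying the `0`-bottom lowers `T⁺` by exactly `E_3(H_0,G_1,G_2)`:
`T⁺(G,H) − T⁺(G, H[0 ↦ ∅]) = E_3(H_0,G_1,G_2)` (prim-ineq-gen-4 g14 (2)). [this work] -/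
theorem twoLevelTop_meetBottom_sub_eq (q : κ → unitInterval) (G H : Fin 3 → Set (Set κ)) (hH1 : H 1 ⊆ G 1) (hH2 : H 2 ⊆ G 2)
    (hm : H 0 ⊆ H 1 ∩ H 2) :
    (twoLevelForm (fun A => (prodBernoulli q).real A) G H
        - ∏ i, ((prodBernoulli q).real (G i) - (prodBernoulli q).real (H i)))
      - (twoLevelForm (fun A => (prodBernoulli q).real A) G (update H 0 ∅)
        - ∏ i, ((prodBernoulli q).real (G i) - (prodBernoulli q).real (update H 0 ∅ i))) =
      sahiE3 (prodBernoulli q) (H 0) (G 1) (G 2) := by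
  have hm' : update H 0 ∅ 0 ⊆ update H 0 ∅ 1 ∩ update H 0 ∅ 2 := by
    rw [update_self]; exact Set.empty_subset _
  have h1 : update H 0 ∅ 1 = H 1 := update_of_ne (by decide) _ _
  have h2 : update H 0 ∅ 2 = H 2 := update_of_ne (by decide) _ _
  have hH1' : update H 0 ∅ 1 ⊆ G 1 := by rw [h1]; exact hH1
  have hH2' : update H 0 ∅ 2 ⊆ G 2 := by rw [h2]; exact hH2
  rw [twoLevelTop_eq_of_meetBottom q G H hH1 hH2 hm, twoLevelTop_eq_of_meetBottom q G (update H 0 ∅) hH1' hH2' hm',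
    h1, h2, update_self]
  have e0 : sahiE3 (prodBernoulli q) (∅ : Set (Set κ)) (G 1) (G 2) = 0 := by
    simp only [sahiE3_def, Set.empty_inter, measureReal_empty]; ring
  rw [e0]
  ring

end Summit.CriticalPhenomena.PercolationContinuityZ3.Theorems.SahiTwoLevelWForm
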